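import Summits.AtomisticToContinuum.Crystallization.Theorems.OverbindingBudgetAffineTaylorCellOrderFiveA

/-!
# OverbindingBudget — Taylor-model cells for the far-window certificate, part 14/16 «OrderFiveB»

MODULE PLAN (lens-4 g68, at hand-2's landing-shape request of 2026-09-02T14:19Z, critic row 1199 (II)) of the VERIFIED g67 leaf
`OverbindingBudgetAffineTaylorCell.lean` (sha256 `dabedef39e0c5fd2…`, 4214 l, critic row 1196): this module = leaf l.3480–3720
(§10 (second half): slot polynomial, rounding, acc soundness J=5, check5 and check5_sound), body VERBATIM except as listed in `MAP.md` — here: example l.3723-3724 removed.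
Same namespace `…Theorems.OverbindingBudgetAffineTaylorCell` in all 16 parts (declaration names unchanged); the parts import each other
linearly.  No `sorry`, no `native_decide`, standard axioms; no instances/notation; scoped `set_option maxHeartbeats` with explicit bounds only.
-/

namespace Summit.AtomisticToContinuum.Crystallization.Theorems.OverbindingBudgetAffineTaylorCell

/-- Step 2 (swap of the two finite sums): the family model is the slot polynomial with the summed exact coefficients. -/
def Cell.pcoef5 (C : Cell) (vs : List (ℤ × ℤ × ℤ)) (mo : Mono) : ℚ :=
  (vs.map fun N => if mo.d < 5 then C.termQ N.1 N.2.1 N.2.2 mo else 0).sum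

/-- `Cell.modelSum5_eq` (docstring added by the landing lane; see the module docstring). [formal bookkeeping] -/
theorem Cell.modelSum5_eq (C : Cell) (vs : List (ℤ × ℤ × ℤ)) (t1 t2 t3 t4 t5 : ℝ) :
    C.modelSum5 vs t1 t2 t3 t4 t5 = (monos.map fun mo => (C.pcoef5 vs mo : ℝ) * mo.ev t1 t2 t3 t4 t5).sum := by
  unfold Cell.modelSum5 Cell.termModel5
  rw [sum_map_sum_map_mul]
  congr 1
  apply List.map_congr_left
  intro mo _
  congr 1
  unfold Cell.pcoef5
  rw [Rat.cast_list_sum, List.map_map]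
  congr 1
  apply List.map_congr_left
  intro N _
  simp only [Function.comp]
  split_ifs <;> simp

/-- Step 3: the kernel's coefficient of slot `mo` is within `|vs|/D` (below) of the exact one. -/
theorem Cell.rcSum5_le (C : Cell) (hJ : C.J = 5) (hD : 0 < C.D) (mo : Mono) :
    ∀ vs : List (ℤ × ℤ × ℤ), (∀ N ∈ vs, 0 < C.cOf N.1 N.2.1 N.2.2 ∧ C.UOf N.1 N.2.1 N.2.2 < 1 / 2) →
      (vs.map fun N => C.rc N mo).sum ≤ C.pcoef5 vs mo ∧
        C.pcoef5 vs mo ≤ (vs.map fun N => C.rc N mo).sum + vs.length / C.D := by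
  intro vs
  induction vs with
  | nil => intro _; simp [Cell.pcoef5]
  | cons N vs ih =>
    intro hadm
    have hN := hadm N (by simp)
    have hrest := ih (fun M hM => hadm M (by simp [hM]))
    unfold Cell.pcoef5 at hrest ⊢
    rw [List.map_cons, List.sum_cons, List.map_cons, List.sum_cons, List.length_cons]
    by_cases hd : mo.d < 5
    · rw [if_pos hd]
      have h := C.rc_le hD hN.1 mo (hJ ▸ hd)
      have hD' : (0 : ℚ) < C.D := by exact_mod_cast hD
      constructor
      · linarith [h.1, hrest.1]
      · have : ((vs.length + 1 : ℕ) : ℚ) / C.D = vs.length / C.D + 1 / C.D := by push_cast; ring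
        rw [this]; linarith [h.2, hrest.2]
    · rw [if_neg hd, C.rc_of_ge mo (hJ ▸ hd)]
      have hD' : (0 : ℚ) < C.D := by exact_mod_cast hD
      constructor
      · linarith [hrest.1]
      · have : ((vs.length + 1 : ℕ) : ℚ) / C.D = vs.length / C.D + 1 / C.D := by push_cast; ring
        rw [this]
        have : (0 : ℚ) ≤ 1 / C.D := by positivity
        linarith [hrest.2]

/-- CELL SOUNDNESS (`m = 3`, order `J = 5`): on the whole box `|t_i| ≤ h_i` (`h_i ≤ 1`), the kernel polynomial is within
`rem + 126·|vs|/D` of the true near sum `Σ_N s_N(t)^{-3}` of the (admissible, `ok = true`) family. -/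
theorem Cell.acc_sound_m3_J5 (C : Cell) (hm : C.m = 3) (hJ : C.J = 5) (hD : 0 < C.D)
    (hh1 : C.h1 ≤ 1) (hh2 : C.h2 ≤ 1) (hh3 : C.h3 ≤ 1) (hh4 : C.h4 ≤ 1) (hh5 : C.h5 ≤ 1)
    (vs : List (ℤ × ℤ × ℤ)) (hok : (C.acc vs).ok = true) (t1 t2 t3 t4 t5 : ℝ)
    (h1 : |t1| ≤ C.h1) (h2 : |t2| ≤ C.h2) (h3 : |t3| ≤ C.h3) (h4 : |t4| ≤ C.h4) (h5 : |t5| ≤ C.h5) :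
    |C.trueSum 3 vs t1 t2 t3 t4 t5 - evalCoef (C.acc vs).coef t1 t2 t3 t4 t5|
      ≤ ((C.acc vs).rem : ℝ) + 126 * (vs.length / C.D : ℚ) := by
  have hadm := (C.acc_ok_iff vs).1 hok
  have s1 := C.trueSum_sub_modelSum5_m3 hm hJ hD t1 t2 t3 t4 t5 h1 h2 h3 h4 h5 vs hadm
  rw [← C.acc_rem] at s1
  have s2 : |C.modelSum5 vs t1 t2 t3 t4 t5 - evalCoef (C.acc vs).coef t1 t2 t3 t4 t5| ≤ 126 * (vs.length / C.D : ℚ) := by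
    rw [C.modelSum5_eq, C.evalCoef_acc]
    have h := slotPoly_sub_le monos (fun mo => (C.pcoef5 vs mo : ℝ)) (fun mo => (((vs.map fun N => C.rc N mo).sum : ℚ) : ℝ))
      (fun mo => mo.ev t1 t2 t3 t4 t5) ((vs.length / C.D : ℚ) : ℝ) ?_ ?_
    · simpa [monos_length] using h
    · intro mo _
      have hb := C.rcSum5_le hJ hD mo vs hadm
      rw [abs_le]
      constructor
      · have : (((vs.map fun N => C.rc N mo).sum : ℚ) : ℝ) ≤ (C.pcoef5 vs mo : ℝ) := by exact_mod_cast hb.1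
        have h0 : (0 : ℝ) ≤ ((vs.length / C.D : ℚ) : ℝ) := by
          have : (0 : ℚ) ≤ vs.length / C.D := by positivity
          exact_mod_cast this
        linarith
      · have : (C.pcoef5 vs mo : ℝ) ≤ (((vs.map fun N => C.rc N mo).sum : ℚ) : ℝ) + ((vs.length / C.D : ℚ) : ℝ) := by
          exact_mod_cast hb.2
        linarith
    · intro mo _
      exact mo.ev_abs_le_one t1 t2 t3 t4 t5 (h1.trans (by exact_mod_cast hh1)) (h2.trans (by exact_mod_cast hh2))
        (h3.trans (by exact_mod_cast hh3)) (h4.trans (by exact_mod_cast hh4)) (h5.trans (by exact_mod_cast hh5))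
  calc |C.trueSum 3 vs t1 t2 t3 t4 t5 - evalCoef (C.acc vs).coef t1 t2 t3 t4 t5|
      = |(C.trueSum 3 vs t1 t2 t3 t4 t5 - C.modelSum5 vs t1 t2 t3 t4 t5)
          + (C.modelSum5 vs t1 t2 t3 t4 t5 - evalCoef (C.acc vs).coef t1 t2 t3 t4 t5)| := by ring_nf
    _ ≤ _ := abs_add_le _ _
    _ ≤ _ := add_le_add s1 s2

/-- CELL SOUNDNESS (`m = 6`, order `J = 5`). -/
theorem Cell.acc_sound_m6_J5 (C : Cell) (hm : C.m = 6) (hJ : C.J = 5) (hD : 0 < C.D)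
    (hh1 : C.h1 ≤ 1) (hh2 : C.h2 ≤ 1) (hh3 : C.h3 ≤ 1) (hh4 : C.h4 ≤ 1) (hh5 : C.h5 ≤ 1)
    (vs : List (ℤ × ℤ × ℤ)) (hok : (C.acc vs).ok = true) (t1 t2 t3 t4 t5 : ℝ)
    (h1 : |t1| ≤ C.h1) (h2 : |t2| ≤ C.h2) (h3 : |t3| ≤ C.h3) (h4 : |t4| ≤ C.h4) (h5 : |t5| ≤ C.h5) :
    |C.trueSum 6 vs t1 t2 t3 t4 t5 - evalCoef (C.acc vs).coef t1 t2 t3 t4 t5|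
      ≤ ((C.acc vs).rem : ℝ) + 126 * (vs.length / C.D : ℚ) := by
  have hadm := (C.acc_ok_iff vs).1 hok
  have s1 := C.trueSum_sub_modelSum5_m6 hm hJ hD t1 t2 t3 t4 t5 h1 h2 h3 h4 h5 vs hadm
  rw [← C.acc_rem] at s1
  have s2 : |C.modelSum5 vs t1 t2 t3 t4 t5 - evalCoef (C.acc vs).coef t1 t2 t3 t4 t5| ≤ 126 * (vs.length / C.D : ℚ) := by
    rw [C.modelSum5_eq, C.evalCoef_acc]
    have h := slotPoly_sub_le monos (fun mo => (C.pcoef5 vs mo : ℝ)) (fun mo => (((vs.map fun N => C.rc N mo).sum : ℚ) : ℝ))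
      (fun mo => mo.ev t1 t2 t3 t4 t5) ((vs.length / C.D : ℚ) : ℝ) ?_ ?_
    · simpa [monos_length] using h
    · intro mo _
      have hb := C.rcSum5_le hJ hD mo vs hadm
      rw [abs_le]
      constructor
      · have : (((vs.map fun N => C.rc N mo).sum : ℚ) : ℝ) ≤ (C.pcoef5 vs mo : ℝ) := by exact_mod_cast hb.1
        have h0 : (0 : ℝ) ≤ ((vs.length / C.D : ℚ) : ℝ) := by
          have : (0 : ℚ) ≤ vs.length / C.D := by positivity
          exact_mod_cast this
        linarith
      · have : (C.pcoef5 vs mo : ℝ) ≤ (((vs.map fun N => C.rc N mo).sum : ℚ) : ℝ) + ((vs.length / C.D : ℚ) : ℝ) := by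
          exact_mod_cast hb.2
        linarith
    · intro mo _
      exact mo.ev_abs_le_one t1 t2 t3 t4 t5 (h1.trans (by exact_mod_cast hh1)) (h2.trans (by exact_mod_cast hh2))
        (h3.trans (by exact_mod_cast hh3)) (h4.trans (by exact_mod_cast hh4)) (h5.trans (by exact_mod_cast hh5))
  calc |C.trueSum 6 vs t1 t2 t3 t4 t5 - evalCoef (C.acc vs).coef t1 t2 t3 t4 t5|
      = |(C.trueSum 6 vs t1 t2 t3 t4 t5 - C.modelSum5 vs t1 t2 t3 t4 t5)
          + (C.modelSum5 vs t1 t2 t3 t4 t5 - evalCoef (C.acc vs).coef t1 t2 t3 t4 t5)| := by ring_nf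
    _ ≤ _ := abs_add_le _ _
    _ ≤ _ := add_le_add s1 s2

/-- THE ORDER-5 CELL CHECK (kernel-decidable; identical to `check` but for `J = 5`). -/
def CertRow.check5 (R : CertRow) (vs : List (ℤ × ℤ × ℤ)) : Bool :=
  decide ((R.acc3 vs).ok = true ∧ (R.acc6 vs).ok = true ∧ R.C.J = 5 ∧ 0 < R.C.D ∧ R.C.h1 ≤ 1 ∧ R.C.h2 ≤ 1 ∧
    R.C.h3 ≤ 1 ∧ R.C.h4 ≤ 1 ∧ R.C.h5 ≤ 1 ∧ 0 ≤ R.A ∧ 0 ≤ R.B ∧ R.P.dOK = true ∧ 0 ≤ R.margin vs)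

/-- Assemble the row check from separately kernel-decided pieces (each piece = one bounded kernel job). -/
theorem CertRow.check5_of (R : CertRow) (vs : List (ℤ × ℤ × ℤ)) (h3 : (R.acc3 vs).ok = true)
    (h6 : (R.acc6 vs).ok = true)
    (hside : decide (R.C.J = 5 ∧ 0 < R.C.D ∧ R.C.h1 ≤ 1 ∧ R.C.h2 ≤ 1 ∧ R.C.h3 ≤ 1 ∧ R.C.h4 ≤ 1 ∧ R.C.h5 ≤ 1 ∧
      0 ≤ R.A ∧ 0 ≤ R.B ∧ R.P.dOK = true) = true)
    (hm : decide (0 ≤ R.margin vs) = true) : R.check5 vs = true := by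
  have hs := of_decide_eq_true hside
  have hm' := of_decide_eq_true hm
  unfold CertRow.check5
  exact decide_eq_true ⟨h3, h6, hs.1, hs.2.1, hs.2.2.1, hs.2.2.2.1, hs.2.2.2.2.1, hs.2.2.2.2.2.1, hs.2.2.2.2.2.2.1,
    hs.2.2.2.2.2.2.2.1, hs.2.2.2.2.2.2.2.2.1, hs.2.2.2.2.2.2.2.2.2, hm'⟩

/-- The row check from kernel jobs with MATERIALISED slot lists: `hW`/`hV` are `decide`d list equalities. -/
theorem CertRow.check5_of_lit (R : CertRow) (vs : List (ℤ × ℤ × ℤ)) (h3 : (R.acc3 vs).ok = true)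
    (h6 : (R.acc6 vs).ok = true)
    (hside : decide (R.C.J = 5 ∧ 0 < R.C.D ∧ R.C.h1 ≤ 1 ∧ R.C.h2 ≤ 1 ∧ R.C.h3 ≤ 1 ∧ R.C.h4 ≤ 1 ∧ R.C.h5 ≤ 1 ∧
      0 ≤ R.A ∧ 0 ≤ R.B ∧ R.P.dOK = true) = true)
    (W V : List ℚ) (hW : R.W vs = W) (hV : R.V vs = V) (hm : decide (0 ≤ R.marginOf W V) = true) :
    R.check5 vs = true := by
  apply R.check5_of vs h3 h6 hside
  rw [R.margin_eq, hW, hV]; exact hm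

/-- Sharpness side: a materialised margin that is NEGATIVE makes the row check `false` (the cell is too wide for this certificate). -/
theorem CertRow.check5_false_of_lit (R : CertRow) (vs : List (ℤ × ℤ × ℤ)) (W V : List ℚ) (hW : R.W vs = W) (hV : R.V vs = V)
    (hm : decide (0 ≤ R.marginOf W V) = false) : R.check5 vs = false := by
  have hm' : ¬ 0 ≤ R.margin vs := by
    rw [R.margin_eq, hW, hV]; exact of_decide_eq_false hm
  unfold CertRow.check5
  exact decide_eq_false fun h => hm' h.2.2.2.2.2.2.2.2.2.2.2.2

/-- SOUNDNESS OF THE ORDER-5 CELL CHECK: `B·(Σ N^{-3}(t) + far₃)² ≤ A·(Σ N^{-6}(t) + far₆)` on the whole box. -/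
theorem CertRow.check5_sound (R : CertRow) (vs : List (ℤ × ℤ × ℤ)) (hchk : R.check5 vs = true)
    (t1 t2 t3 t4 t5 : ℝ)
    (h1 : |t1| ≤ R.C.h1) (h2 : |t2| ≤ R.C.h2) (h3 : |t3| ≤ R.C.h3) (h4 : |t4| ≤ R.C.h4) (h5 : |t5| ≤ R.C.h5)
    (far3 far6 : ℝ) (hf3 : 0 ≤ far3) (hf3' : far3 ≤ R.F6hi) (hf6 : (R.F12lo : ℝ) ≤ far6) :
    (R.B : ℝ) * (R.C.trueSum 3 vs t1 t2 t3 t4 t5 + far3) ^ 2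
      ≤ (R.A : ℝ) * (R.C.trueSum 6 vs t1 t2 t3 t4 t5 + far6) := by
  have hc := of_decide_eq_true hchk
  obtain ⟨hok3, hok6, hJ, hD, hh1, hh2, hh3, hh4, hh5, hA, hB, hdOK, hmar⟩ := hc
  -- (1) the two accumulations are sound
  have s3 : |R.C.trueSum 3 vs t1 t2 t3 t4 t5 - evalCoef (R.acc3 vs).coef t1 t2 t3 t4 t5|
      ≤ (R.rho vs (R.acc3 vs) : ℝ) := by
    have := (R.C.withM 3).acc_sound_m3_J5 rfl hJ hD hh1 hh2 hh3 hh4 hh5 vs hok3 t1 t2 t3 t4 t5 h1 h2 h3 h4 h5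
    refine this.trans (le_of_eq ?_)
    simp only [CertRow.rho, CertRow.acc3]; rw [show (R.C.withM 3).D = R.C.D from rfl]; push_cast; ring
  have s6 : |R.C.trueSum 6 vs t1 t2 t3 t4 t5 - evalCoef (R.acc6 vs).coef t1 t2 t3 t4 t5|
      ≤ (R.rho vs (R.acc6 vs) : ℝ) := by
    have := (R.C.withM 6).acc_sound_m6_J5 rfl hJ hD hh1 hh2 hh3 hh4 hh5 vs hok6 t1 t2 t3 t4 t5 h1 h2 h3 h4 h5
    refine this.trans (le_of_eq ?_)
    simp only [CertRow.rho, CertRow.acc6]; rw [show (R.C.withM 6).D = R.C.D from rfl]; push_cast; ring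
  -- (2) the six-sum is nonnegative
  have hN3 : 0 ≤ R.C.trueSum 3 vs t1 t2 t3 t4 t5 :=
    R.C.trueSum_nonneg 3 vs t1 t2 t3 t4 t5 h1 h2 h3 h4 h5 (((R.C.withM 3).acc_ok_iff vs).1 hok3)
  -- (3) closed forms of the slot lists
  have hc3 := (R.C.withM 3).acc_coef vs
  have hc6 := (R.C.withM 6).acc_coef vs
  set g3 : Mono → ℚ := fun mo => (vs.map fun N => (R.C.withM 3).rc N mo).sum with hg3
  set g6 : Mono → ℚ := fun mo => (vs.map fun N => (R.C.withM 6).rc N mo).sum with hg6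
  change (R.acc3 vs).coef = monos.map g3 at hc3
  change (R.acc6 vs).coef = monos.map g6 at hc6
  -- W ⊒ six-sum, and 0 ≤ six ≤ W(t)
  have hW : evalCoef (R.W vs) t1 t2 t3 t4 t5
      = evalCoef (R.acc3 vs).coef t1 t2 t3 t4 t5 + ((R.rho vs (R.acc3 vs) + R.F6hi : ℚ) : ℝ) := by
    unfold CertRow.W; rw [hc3, evalCoef_addConst]
  have hSix0 : 0 ≤ R.C.trueSum 3 vs t1 t2 t3 t4 t5 + far3 := by linarith
  have hSixW : R.C.trueSum 3 vs t1 t2 t3 t4 t5 + far3 ≤ evalCoef (R.W vs) t1 t2 t3 t4 t5 := by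
    rw [hW]; push_cast
    have := (abs_le.1 s3).2
    have hf : far3 ≤ (R.F6hi : ℝ) := hf3'
    linarith
  have hSq : (R.C.trueSum 3 vs t1 t2 t3 t4 t5 + far3) ^ 2 ≤ (evalCoef (R.W vs) t1 t2 t3 t4 t5) ^ 2 :=
    pow_le_pow_left₀ hSix0 hSixW 2
  -- V ⊑ twelve-sum
  set fV : Mono → ℚ := fun mo => g6 mo + if mo.d = 0 then R.F12lo - R.rho vs (R.acc6 vs) else 0 with hfV
  have hVl : R.V vs = monos.map fV := by unfold CertRow.V; rw [hc6, addConst_map]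
  have hV : evalCoef (R.V vs) t1 t2 t3 t4 t5
      = evalCoef (R.acc6 vs).coef t1 t2 t3 t4 t5 + ((R.F12lo - R.rho vs (R.acc6 vs) : ℚ) : ℝ) := by
    unfold CertRow.V; rw [hc6, evalCoef_addConst]
  have hVT : evalCoef (R.V vs) t1 t2 t3 t4 t5 ≤ R.C.trueSum 6 vs t1 t2 t3 t4 t5 + far6 := by
    rw [hV]; push_cast
    have := (abs_le.1 s6).1
    linarith
  -- the product W·W
  have hprod := slotProd_sound R.C (R.W vs) (R.W vs) t1 t2 t3 t4 t5 h1 h2 h3 h4 h5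
  -- the certificate polynomial and its lower bound on the box
  set fQ : Mono → ℚ := fun mo => R.A * fV mo - R.B * slotProdCoef (R.W vs) (R.W vs) mo with hfQ
  have hQl : R.Q vs = monos.map fQ := by
    rw [CertRow.Q_eq, hVl]; unfold slotProd; rw [linComb_map]
  have hQe : evalCoef (R.Q vs) t1 t2 t3 t4 t5
      = R.A * evalCoef (R.V vs) t1 t2 t3 t4 t5 - R.B * evalCoef (slotProd (R.W vs) (R.W vs)) t1 t2 t3 t4 t5 := by
    rw [CertRow.Q_eq, hVl]; unfold slotProd; rw [evalCoef_linComb]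
  have hQge := evalCoef_map_ge R.C fQ t1 t2 t3 t4 t5 h1 h2 h3 h4 h5
  have hquad := (qfOf fQ).eval_ge_of_cert R.P hdOK R.C t1 t2 t3 t4 t5 h1 h2 h3 h4 h5
  rw [← hQl] at hQge
  -- the margin
  unfold CertRow.margin at hmar
  rw [slotProdDropF_eq, hQl, getZero_map, qfOfList_map, ← hQl] at hmar
  have hmar' : (0 : ℝ) ≤ (fQ slot0 : ℝ) - (cornerSum R.C (R.Q vs) : ℝ) - (((qfOf fQ).sub R.P.qf).boxLoss R.C : ℝ)
      - R.B * (slotProdDrop R.C (R.W vs) (R.W vs) : ℝ) := by exact_mod_cast hmar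
  -- assemble
  have hA' : (0 : ℝ) ≤ R.A := by exact_mod_cast hA
  have hB' : (0 : ℝ) ≤ R.B := by exact_mod_cast hB
  have hWW : (evalCoef (R.W vs) t1 t2 t3 t4 t5) ^ 2
      ≤ evalCoef (slotProd (R.W vs) (R.W vs)) t1 t2 t3 t4 t5 + (slotProdDrop R.C (R.W vs) (R.W vs) : ℝ) := by
    have := (abs_le.1 hprod).2
    nlinarith
  have k1 : (R.B : ℝ) * (R.C.trueSum 3 vs t1 t2 t3 t4 t5 + far3) ^ 2
      ≤ R.B * (evalCoef (slotProd (R.W vs) (R.W vs)) t1 t2 t3 t4 t5 + (slotProdDrop R.C (R.W vs) (R.W vs) : ℝ)) :=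
    mul_le_mul_of_nonneg_left (hSq.trans hWW) hB'
  have k2 : (R.A : ℝ) * evalCoef (R.V vs) t1 t2 t3 t4 t5 ≤ R.A * (R.C.trueSum 6 vs t1 t2 t3 t4 t5 + far6) :=
    mul_le_mul_of_nonneg_left hVT hA'
  linarith

end Summit.AtomisticToContinuum.Crystallization.Theorems.OverbindingBudgetAffineTaylorCell
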